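import Literature.MathematicalPhysics.KineticTheory.VelocityFlipNoise
import Literature.MathematicalPhysics.KineticTheory.LangevinChainResolvent
import Literature.MathematicalPhysics.KineticTheory.LangevinChainNESSProofs
import Literature.MathematicalPhysics.KineticTheory.LangevinChainLyapunov
import Literature.Probability.Process.KrylovBogoliubovDiscrete
import HarnessLib

/-!
# Existence of weak steady states for the pinned chain with velocity flips (Bernardin–Olla)

Trunk T-KINETIC (Literature/MathematicalPhysics/KineticTheory). Theorems only (no new
definitions). For the pinned anharmonic chain `pinnedChain ω₂ lam β γ` between Langevin baths at
temperatures `T_L, T_R > 0` (`FouriersLaw.lean`), perturbed by independent velocity flips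
`p_i ↦ -p_i` at rate `ε` at every site (`VelocityFlipNoise.lean`: the generator
`L_ε = L + ε S`, `S f = ∑_i (f ∘ momentumFlip i - f)`), a **weak flip steady state**
(`OscillatorChain.IsFlipSteadyState`: a probability measure with `∫ L_ε f dμ = 0` for all
`f ∈ C_c^∞` and integrable bond currents) EXISTS for every `N`, all `T_L, T_R > 0` and every rate
`ε > 0` (`pinnedChain_exists_isFlipSteadyState`). Bernardin–Olla 2011, Prop. 1 state existence
(and uniqueness) of the stationary state for their unpinned chain with flips; here the pinned BLR
chain, in the weak Fokker–Planck form used by the summit statement. Uniqueness is NOT treated here.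

## The construction: the chain embedded at the flip times

Let `R = R_{Nε}` be the resolvent kernel of the flip-free transition semigroup at rate `N ε`
(`LangevinChainResolvent.lean`, `pinnedChain_exists_resolventKernel`: the law of the flip-free
chain observed at an independent exponential time of rate `Nε`; it satisfies the resolvent
(Dynkin) identity `R(Lf) = Nε (R f - f)` on `C_c^∞`, is Feller, and contracts `e^{θH}`:
`R e^{θH} ≤ a e^{θH} + b`, `a < 1`), and let `Q` flip a uniformly chosen momentum,
`Q(z, ·) = N⁻¹ ∑_i δ_{z^i}`. The flip dynamics run the flip-free dynamics between the events of a
rate-`Nε` Poisson clock and apply `Q` at the events, so the chain observed just after the flip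
times has transition kernel `K = Q ∘ₖ R` (first `R`, then `Q`). `K` is Markov, Feller
(`Q` maps bounded continuous functions to bounded continuous functions, `momentumFlip i` being
continuous) and has the Lyapunov function `e^{θH}` with the constants of `R` (`H ∘ momentumFlip i
= H`, `hamiltonian_momentumFlip`); `e^{θH}` is continuous with compact sublevel sets
(`pinnedChain_isCompact_setOf_exp_le`). The discrete-time Krylov–Bogoliubov / Foster–Lyapunov
theorem (`KrylovBogoliubovDiscrete.lean`, `MarkovChain.exists_invariant_of_lyapunov`) gives an
invariant probability measure `π = π K` with `∫ e^{θH} dπ < ∞`, and `μ := π R` is the steady state: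
for `f ∈ C_c^∞`, `∫ Lf dμ = ∫ R(Lf) dπ = Nε (μ f - π f)` by the resolvent identity, while
`ε ∫ S f dμ = Nε (μ(Qf) - μ f) = Nε (π f - μ f)` because `μ Q = π R Q = π K = π`; the two cancel.
Finally `∫ e^{θH} dμ = ∫ R e^{θH} dπ ≤ a ∫ e^{θH} dπ + b < ∞`, so the polynomial bond currents are
`μ`-integrable (`pinnedChain_integrable_bondCurrent_of_integrable_exp`). This is
`exists_isFlipSteadyState_of_resolventKernel`, stated for an abstract kernel `R` with the three
properties; `pinnedChain_exists_isFlipSteadyState` feeds it the resolvent kernel for `N ≥ 2`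
(`θ = 1/(2 max(T_L,T_R))`) and uses the Dirac mass for `N = 0` (`isFlipSteadyState_zero_sites`)
and the Gibbs measure at the mean temperature for `N = 1`
(`pinnedChain_isFlipSteadyState_gibbsMeasure_one`).

## References

* C. Bernardin, S. Olla, *Transport properties of a chain of anharmonic oscillators with random
  flip of velocities*, J. Stat. Phys. 145 (2011) 1224–1255, §2.1 and Prop. 1.
* S. P. Meyn, R. L. Tweedie, *Markov Chains and Stochastic Stability* (1993), Thm 12.1.2,
  Prop. 12.1.3 (Krylov–Bogoliubov / Foster–Lyapunov for Feller chains).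
* S. N. Ethier, T. G. Kurtz, *Markov Processes* (1986), Ch. 4 §2 (resolvent identity) and
  Ch. 4 §10 (piecewise-deterministic / jump perturbations of a Markov process).
-/

noncomputable section

open MeasureTheory ProbabilityTheory Filter Topology
open scoped NNReal ENNReal ContDiff BoundedContinuousFunction

namespace Literature.MathematicalPhysics.KineticTheory.HeatConduction

/-! ### The embedded chain at the flip times -/

/-- **Embedded flip chain ⟹ weak flip steady state.** Let `P = pinnedChain ω₂ lam β γ`
(`ω₂ > 0`, `lam, β ≥ 0`), `N ≥ 1`, and let `R` be a Markov kernel on phase space with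
(i) the resolvent identity at rate `N ε` on `C_c^∞`: `∫ Lf dR(z,·) = Nε (∫ f dR(z,·) - f z)`;
(ii) the Feller property: `z ↦ ∫ g dR(z,·)` is continuous for bounded continuous `g`;
(iii) a contracting bound for `e^{θH}` (`θ > 0`): `∫ e^{θH} dR(z,·) ≤ a e^{θH(z)} + b` with `a < 1`,
`b < ∞`. Let `Q(z,·) = N⁻¹ ∑_i δ_{z^i}` flip a uniformly chosen momentum. Then the embedded chain
`K = Q ∘ₖ R` is Markov, Feller, and `K e^{θH} = R e^{θH} ≤ a e^{θH} + b` (`H(z^i) = H(z)`), so by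
the discrete Krylov–Bogoliubov / Foster–Lyapunov theorem it has an invariant probability measure
`π` with `∫ e^{θH} dπ < ∞`; and `μ := π R` is a weak flip steady state of `L + εS`: for
`f ∈ C_c^∞`,
`∫ Lf dμ = Nε(μ f - π f)` (resolvent identity) and `ε ∫ Sf dμ = Nε(μ(Qf) - μ f) = Nε(π f - μ f)`
(`μ Q = π (Q ∘ₖ R) = π`) cancel, and `∫ e^{θH} dμ ≤ a ∫ e^{θH} dπ + b < ∞` makes the bond
currents integrable (`pinnedChain_integrable_bondCurrent_of_integrable_exp`). The standard
embedded-chain / uniformisation construction of stationary laws for a Markov process perturbed by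
Poissonian jumps (cf. Ethier–Kurtz 1986, Ch. 4; Bernardin–Olla 2011, Prop. 1 for the flip chain).
[folklore] -/
theorem exists_isFlipSteadyState_of_resolventKernel {ω₂ lam β γ : ℝ} (hω : 0 < ω₂) (hl : 0 ≤ lam)
    (hβ : 0 ≤ β) {N : ℕ} (hN : 0 < N) (T_L T_R ε : ℝ)
    (R : Kernel (PhaseSpace N) (PhaseSpace N)) [IsMarkovKernel R]
    (hres : ∀ f : PhaseSpace N → ℝ, ContDiff ℝ ∞ f → HasCompactSupport f → ∀ z : PhaseSpace N,
        ∫ y, (pinnedChain ω₂ lam β γ).generator N T_L T_R f y ∂(R z) =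
          (N * ε) * (∫ y, f y ∂(R z) - f z))
    (hfeller : ∀ g : PhaseSpace N →ᵇ ℝ, Continuous fun z => ∫ y, g y ∂(R z))
    {θ : ℝ} (hθ : 0 < θ) {a b : ℝ≥0∞} (ha : a < 1) (hb : b ≠ ⊤)
    (hlyap : ∀ z : PhaseSpace N,
        ∫⁻ y, ENNReal.ofReal (Real.exp (θ * (pinnedChain ω₂ lam β γ).hamiltonian N y)) ∂(R z) ≤
          a * ENNReal.ofReal (Real.exp (θ * (pinnedChain ω₂ lam β γ).hamiltonian N z)) + b) :
    ∃ μ : Measure (PhaseSpace N), (pinnedChain ω₂ lam β γ).IsFlipSteadyState N T_L T_R ε μ := by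
  set P := pinnedChain ω₂ lam β γ with hP
  have hN0 : (N : ℝ≥0∞) ≠ 0 := Nat.cast_ne_zero.2 hN.ne'
  have hNtop : (N : ℝ≥0∞) ≠ ⊤ := ENNReal.natCast_ne_top N
  have hNR : (N : ℝ) ≠ 0 := Nat.cast_ne_zero.2 hN.ne'
  -- bounded continuous observables are integrable for finite measures
  have hbdd_int {g : PhaseSpace N → ℝ} (hg : Continuous g) {C : ℝ} (hC : ∀ x, ‖g x‖ ≤ C)
      (ν : Measure (PhaseSpace N)) [IsFiniteMeasure ν] : Integrable g ν :=
    (integrable_const C).mono' hg.aestronglyMeasurable (Eventually.of_forall hC)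
  /- (i) the flip kernel `Q z = N⁻¹ ∑_i δ_{z^i}`: flip a uniformly chosen momentum -/
  let Q : Kernel (PhaseSpace N) (PhaseSpace N) :=
    ⟨fun z => (N : ℝ≥0∞)⁻¹ • ∑ i : Fin N, Measure.dirac (momentumFlip i z), by
      refine Measure.measurable_of_measurable_coe _ fun s hs => ?_
      simp only [Measure.smul_apply, Measure.finsetSum_apply, Measure.dirac_apply' _ hs,
        smul_eq_mul]
      exact (Finset.measurable_sum _ fun i _ =>
        (measurable_one.indicator hs).comp (measurable_momentumFlip i)).const_mul _⟩
  have hQapply : ∀ z, Q z = (N : ℝ≥0∞)⁻¹ • ∑ i : Fin N, Measure.dirac (momentumFlip i z) :=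
    fun z => rfl
  have hQlint : ∀ (W : PhaseSpace N → ℝ≥0∞) (z : PhaseSpace N),
      ∫⁻ y, W y ∂(Q z) = (N : ℝ≥0∞)⁻¹ * ∑ i : Fin N, W (momentumFlip i z) := by
    intro W z
    rw [hQapply, lintegral_smul_measure, lintegral_finsetSum_measure, smul_eq_mul]
    simp only [lintegral_dirac]
  have hQint : ∀ (g : PhaseSpace N → ℝ) (z : PhaseSpace N),
      ∫ y, g y ∂(Q z) = (N : ℝ)⁻¹ * ∑ i : Fin N, g (momentumFlip i z) := by
    intro g z
    rw [hQapply, integral_smul_measure,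
      integral_finsetSum_measure fun i _ => integrable_dirac enorm_lt_top, smul_eq_mul,
      ENNReal.toReal_inv, ENNReal.toReal_natCast]
    simp only [integral_dirac]
  haveI hQmarkov : IsMarkovKernel Q := by
    refine ⟨fun z => ⟨?_⟩⟩
    rw [hQapply, Measure.smul_apply, Measure.finsetSum_apply]
    simp only [measure_univ, Finset.sum_const, Finset.card_univ, Fintype.card_fin, nsmul_eq_mul,
      mul_one, smul_eq_mul]
    exact ENNReal.inv_mul_cancel hN0 hNtop
  /- the Lyapunov function `V = e^{θH}`, invariant under the flips -/
  let V : PhaseSpace N → ℝ≥0 := fun x => (Real.exp (θ * P.hamiltonian N x)).toNNReal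
  have hVapply : ∀ x, (V x : ℝ≥0∞) = ENNReal.ofReal (Real.exp (θ * P.hamiltonian N x)) :=
    fun x => rfl
  have hVcont : Continuous V := continuous_real_toNNReal.comp (Real.continuous_exp.comp
    (continuous_const.mul (pinnedChain_continuous_hamiltonian ω₂ lam β γ N)))
  have hVmeas : Measurable fun x => (V x : ℝ≥0∞) :=
    measurable_coe_nnreal_ennreal.comp hVcont.measurable
  have hcpt : ∀ r : ℝ≥0, IsCompact {x | V x ≤ r} := fun r =>
    pinnedChain_isCompact_setOf_exp_le hω hl hβ γ N hθ r
  have hVflip : ∀ (i : Fin N) (x : PhaseSpace N), V (momentumFlip i x) = V x := by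
    intro i x
    simp only [V, OscillatorChain.hamiltonian_momentumFlip]
  have hQV : ∀ x, ∫⁻ y, (V y : ℝ≥0∞) ∂(Q x) = V x := by
    intro x
    rw [hQlint]
    simp only [hVflip, Finset.sum_const, Finset.card_univ, Fintype.card_fin, nsmul_eq_mul]
    rw [← mul_assoc, ENNReal.inv_mul_cancel hN0 hNtop, one_mul]
  /- (ii) the embedded chain `K = Q ∘ₖ R` is Markov, Feller and has the Lyapunov function `V` -/
  have hKlyap : ∀ z, ∫⁻ y, (V y : ℝ≥0∞) ∂((Q ∘ₖ R) z) ≤ a * V z + b := by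
    intro z
    rw [Kernel.lintegral_comp _ _ _ hVmeas]
    simp_rw [hQV]
    exact hlyap z
  have hKfeller : ∀ g : PhaseSpace N →ᵇ ℝ, Continuous fun z => ∫ y, g y ∂((Q ∘ₖ R) z) := by
    intro g
    let g' : PhaseSpace N →ᵇ ℝ :=
      (N : ℝ)⁻¹ • ∑ i : Fin N, g.compContinuous ⟨momentumFlip i, continuous_momentumFlip i⟩
    have hg' : ∀ x, ∫ y, g y ∂(Q x) = g' x := by
      intro x
      rw [hQint]
      simp only [g', BoundedContinuousFunction.coe_smul, BoundedContinuousFunction.coe_sum,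
        Finset.sum_apply, BoundedContinuousFunction.compContinuous_apply, ContinuousMap.coe_mk,
        smul_eq_mul]
    have heq : (fun z => ∫ y, g y ∂((Q ∘ₖ R) z)) = fun z => ∫ x, g' x ∂(R z) := by
      funext z
      rw [Kernel.comp_apply,
        Literature.Probability.Process.MarkovChain.integral_bind_eq_integral_integral Q (R z)
          g.continuous.stronglyMeasurable (fun x => g.norm_coe_le_norm x)]
      exact integral_congr_ae (Eventually.of_forall hg')
    rw [heq]
    exact hfeller g'
  /- (iii) discrete Krylov–Bogoliubov: an invariant probability measure `π` of `K` -/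
  obtain ⟨π, hπ, hinv, hVfin⟩ :=
    Literature.Probability.Process.MarkovChain.exists_invariant_of_lyapunov (Q ∘ₖ R) hKfeller V
      hVcont hcpt ha hb hKlyap 0
  have hbindQ : (π.bind R).bind Q = π := Measure.comp_assoc.trans hinv.def
  /- (iv) `μ := π R` is a weak flip steady state -/
  refine ⟨π.bind R, ?_⟩
  unfold OscillatorChain.IsFlipSteadyState
  refine ⟨inferInstance, fun f hf hfc => ?_, fun i => ?_⟩
  · -- the weak equation `∫ (L f + ε S f) d(π R) = 0`
    have hf2 : ContDiff ℝ 2 f := hf.of_le (by norm_cast)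
    have hLc : Continuous (P.generator N T_L T_R f) :=
      P.continuous_generator (pinnedChain_contDiff_U ω₂ lam β γ) (pinnedChain_contDiff_V ω₂ lam β γ)
        N T_L T_R hf2
    obtain ⟨CL, hCL⟩ := P.exists_bound_generator (pinnedChain_contDiff_U ω₂ lam β γ)
      (pinnedChain_contDiff_V ω₂ lam β γ) N T_L T_R hf2 hfc
    obtain ⟨Cf, hCf⟩ : ∃ C, ∀ x, ‖f x‖ ≤ C := hf.continuous.bounded_above_of_compact_support hfc
    -- `z ↦ R f (z)` is continuous (Feller) and bounded
    have hRf_cont : Continuous fun z => ∫ y, f y ∂(R z) := by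
      simpa using hfeller (BoundedContinuousFunction.ofNormedAddCommGroup f hf.continuous Cf hCf)
    have hRf_bd : ∀ z, ‖∫ y, f y ∂(R z)‖ ≤ Cf := fun z => by
      simpa using norm_integral_le_of_norm_le_const (μ := R z) (Eventually.of_forall hCf)
    -- `x ↦ Q f (x)` is continuous and bounded
    have hQf_cont : Continuous fun x => ∫ y, f y ∂(Q x) := by
      simp_rw [hQint]
      exact continuous_const.mul
        (continuous_finsetSum _ fun i _ => hf.continuous.comp (continuous_momentumFlip i))
    have hQf_bd : ∀ x, ‖∫ y, f y ∂(Q x)‖ ≤ Cf := fun x => by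
      simpa using norm_integral_le_of_norm_le_const (μ := Q x) (Eventually.of_forall hCf)
    have hμf : ∫ x, f x ∂(π.bind R) = ∫ z, ∫ y, f y ∂(R z) ∂π :=
      Literature.Probability.Process.MarkovChain.integral_bind_eq_integral_integral R π
        hf.continuous.stronglyMeasurable hCf
    -- the generator part: resolvent identity, `∫ L f d(π R) = N ε (∫ f d(π R) - ∫ f dπ)`
    have h1 : ∫ x, P.generator N T_L T_R f x ∂(π.bind R) =
        (N * ε) * (∫ x, f x ∂(π.bind R) - ∫ x, f x ∂π) := by
      rw [Literature.Probability.Process.MarkovChain.integral_bind_eq_integral_integral R π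
        hLc.stronglyMeasurable hCL]
      simp_rw [hres f hf hfc]
      rw [integral_const_mul, integral_sub (hbdd_int hRf_cont hRf_bd π)
        (hbdd_int hf.continuous hCf π), hμf]
    -- the flip part: invariance of `π` under `Q ∘ₖ R`, `∫ S f d(π R) = N (∫ f dπ - ∫ f d(π R))`
    have hQf : ∀ x, (∑ i : Fin N, (f (momentumFlip i x) - f x)) =
        N * ∫ y, f y ∂(Q x) - N * f x := by
      intro x
      rw [hQint, ← mul_assoc, mul_inv_cancel₀ hNR, one_mul, Finset.sum_sub_distrib]
      simp only [Finset.sum_const, Finset.card_univ, Fintype.card_fin, nsmul_eq_mul]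
    have hA : Integrable (fun x => (N : ℝ) * ∫ y, f y ∂(Q x)) (π.bind R) :=
      (hbdd_int hQf_cont hQf_bd _).const_mul _
    have hB : Integrable (fun x => (N : ℝ) * f x) (π.bind R) :=
      (hbdd_int hf.continuous hCf _).const_mul _
    have hS : Integrable (fun x => ∑ i : Fin N, (f (momentumFlip i x) - f x)) (π.bind R) := by
      simp_rw [hQf]
      exact hA.sub hB
    have h2 : ∫ x, (∑ i : Fin N, (f (momentumFlip i x) - f x)) ∂(π.bind R) =
        N * (∫ x, f x ∂π - ∫ x, f x ∂(π.bind R)) := by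
      simp_rw [hQf]
      rw [integral_sub hA hB, integral_const_mul, integral_const_mul,
        ← Literature.Probability.Process.MarkovChain.integral_bind_eq_integral_integral Q (π.bind R)
          hf.continuous.stronglyMeasurable hCf, hbindQ]
      ring
    simp only [OscillatorChain.flipGenerator_apply]
    rw [integral_add (hbdd_int hLc hCL _) (hS.const_mul ε), integral_const_mul, h1, h2]
    ring
  · -- integrable bond currents, from `∫⁻ e^{θH} d(π R) ≤ a ∫⁻ e^{θH} dπ + b < ⊤`
    refine pinnedChain_integrable_bondCurrent_of_integrable_exp hω.le hl hβ γ N hθ ?_ i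
    refine ⟨(Real.continuous_exp.comp (continuous_const.mul
      (pinnedChain_continuous_hamiltonian ω₂ lam β γ N))).aestronglyMeasurable, ?_⟩
    simp only [hVapply] at hVfin
    show ∫⁻ x, ‖Real.exp (θ * P.hamiltonian N x)‖ₑ ∂(π.bind R) < ⊤
    simp only [Real.enorm_eq_ofReal (Real.exp_nonneg _)]
    calc ∫⁻ x, ENNReal.ofReal (Real.exp (θ * P.hamiltonian N x)) ∂(π.bind R)
        ≤ a * ∫⁻ x, ENNReal.ofReal (Real.exp (θ * P.hamiltonian N x)) ∂π + b * π Set.univ :=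
          Literature.Probability.Process.MarkovChain.lintegral_bind_le_of_lyapunov R hVmeas hlyap π
      _ < ⊤ := by
          rw [measure_univ, mul_one]
          exact ENNReal.add_lt_top.2 ⟨ENNReal.mul_lt_top (ha.trans_le le_top) hVfin, hb.lt_top⟩

/-! ### Existence of the weak flip steady state of the pinned anharmonic chain -/

section Pinned

variable {ω₂ lam β γ : ℝ}

/-- **Existence of the weak flip steady state (pinned anharmonic chain, all `N`).** For
`pinnedChain ω₂ lam β γ` with `ω₂, lam, β, γ > 0`, every flip rate `ε > 0`, every `N` and all bath
temperatures `T_L, T_R > 0` there is a probability measure `μ` on phase space with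
`∫ (L f + ε S f) dμ = 0` for all `f ∈ C_c^∞` and integrable bond currents
(`OscillatorChain.IsFlipSteadyState`). `N = 0`: the point mass (`isFlipSteadyState_zero_sites`);
`N = 1`: the Gibbs measure at the mean temperature `(T_L + T_R)/2`
(`pinnedChain_isFlipSteadyState_gibbsMeasure_one`); `N ≥ 2`: `μ = π R_{Nε}` for the chain
embedded at the flip times (`exists_isFlipSteadyState_of_resolventKernel`) with the resolvent
kernel of the flip-free transition semigroup (`pinnedChain_exists_resolventKernel`, Lyapunov
exponent `θ = 1/(2 max(T_L, T_R))`). Bernardin–Olla 2011, Prop. 1 ("there exists a unique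
stationary probability measure `μ_ss` for `L`"), printed for the semigroup of the unpinned chain
with flips at the interior sites; here the existence half, for the BLR pinned chain with flips at
every site, in the weak (Fokker–Planck) form. [cite: BernardinOlla2011, Prop. 1] -/
theorem pinnedChain_exists_isFlipSteadyState (hω : 0 < ω₂) (hl : 0 < lam) (hβ : 0 < β)
    (hγ : 0 < γ) {ε : ℝ} (hε : 0 < ε) (N : ℕ) {T_L T_R : ℝ} (hL : 0 < T_L) (hR : 0 < T_R) :
    ∃ μ : Measure (PhaseSpace N), (pinnedChain ω₂ lam β γ).IsFlipSteadyState N T_L T_R ε μ := by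
  match N with
  | 0 => exact ⟨_, (pinnedChain ω₂ lam β γ).isFlipSteadyState_zero_sites T_L T_R ε⟩
  | 1 => exact ⟨_, pinnedChain_isFlipSteadyState_gibbsMeasure_one hω hl.le hβ.le γ hL hR ε⟩
  | n + 2 =>
    have hmax : 0 < max T_L T_R := lt_max_of_lt_left hL
    have hθ : (0 : ℝ) < 1 / max T_L T_R / 2 := by positivity
    have hθ' : 1 / max T_L T_R / 2 < 1 / max T_L T_R := half_lt_self (by positivity)
    have hr : (0 : ℝ) < ((n + 2 : ℕ) : ℝ) * ε := by positivity
    obtain ⟨R, hRm, hres, hfel, a, b, ha, hb, hly⟩ :=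
      pinnedChain_exists_resolventKernel hω hl hβ hγ (by omega : 1 < n + 2) hL hR hr hθ hθ'
    exact exists_isFlipSteadyState_of_resolventKernel hω hl.le hβ.le (by omega) T_L T_R ε R hres
      hfel hθ ha hb hly

end Pinned

end Literature.MathematicalPhysics.KineticTheory.HeatConduction
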